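import Summits.RiemannHypothesis.RiemannHypothesis.Theses.WeilComb
import Summits.RiemannHypothesis.RiemannHypothesis.Theorems.WeilCombCombSubcriticalStubAutocorrelation
import Summits.RiemannHypothesis.RiemannHypothesis.Theorems.WeilCombCombShapeAdmissible
import Literature.NumberTheory.LFunctions.WeilExplicit
import Literature.NumberTheory.LFunctions.WeilMellinBounds
import Literature.NumberTheory.LFunctions.WeilWindowSimpleEven
import Literature.NumberTheory.LFunctions.WeilGroundEnergyProofs

/-!
# Sub-goal `weilArchTerm_comb_eq_sum` (arch Gram form) of line `Sketch` / `stub_window`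
for crux `WeilComb.CombShapePositivity`
(item stmt-RiemannHypothesis-11229, route route-RiemannHypothesis-WeilComb)

The ARCHIMEDEAN term alone distributes over the comb autocorrelation. Notation:
`φ₀(u) = expNegInvGlue (1 - u²)` (the route's fixed bump, a Weil test by
`weilComb_shapeBump_isWeilTest`), `φ_ε(t) = ε⁻¹ φ₀(t/ε)`, `ψ_ε = φ_ε ⋆ φ̃_ε`
(`weilConv` / `weilReflect`), `τ_x h = weilTranslate h x = h(· − x)`, comb
`g(x) = Σ_{m ≤ M} a_m φ_ε(x − log m)`, `W_∞ = weilArchTerm`.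

**Statement.** For `ε > 0`,
`W_∞(g ⋆ g̃) = Σ_{m, m' ∈ [1, M]} a_m conj(a_{m'}) W_∞(τ_{log m − log m'} ψ_ε)`.

**Proof.** The comb autocorrelation
`g ⋆ g̃ = Σ_{m,m'} a_m conj(a_{m'}) τ_{log m − log m'} ψ_ε` (as functions) is the in-tree
`WeilCombSubcritical.stub_autocorrelation` instantiated at `φ := φ₀`. Each summand
`t ↦ a_m conj(a_{m'}) (τ_{log m − log m'} ψ_ε)(t)` is a Weil test (`ψ_ε` is one, being the
convolution of the test `φ_ε` with its reflection; translates and scalar multiples of tests are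
tests), so `W_∞ = (1/2π) weilArchIntegral − (· 0) log π` distributes over the finite double sum
(`weilArchIntegral_add` by induction on the `Finset`, the empty case being `W_∞(0) = 0`), and
finally `W_∞(c k) = c W_∞(k)` (hypothesis-free, from `weilMellin_const_mul`). This is the proof of
the landed `stub_gram` with `weilArchTerm` in place of `weilFunctional`.
-/

noncomputable section

-- the sub-problem path RiemannHypothesis/RiemannHypothesis duplicates a namespace (D-0017)
set_option linter.dupNamespace false

open scoped BigOperators ComplexConjugate
open Complex MeasureTheory Set

namespace Summit.RiemannHypothesis.RiemannHypothesis.Theorems.WeilCombBohrFejer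

open Literature.NumberTheory.LFunctions

/-- `φ_ε = ε⁻¹ φ(·/ε)` is a Weil test function for `ε ≠ 0` (smoothness of `t ↦ t/ε`; the support is
the image of a compact set under the homeomorphism `t ↦ ε t`). [folklore] -/
private theorem isWeilTest_dil_archGram {φ : ℝ → ℂ} {ε : ℝ} (hφ : IsWeilTest φ) (hε : ε ≠ 0) :
    IsWeilTest (fun t : ℝ => (ε : ℂ)⁻¹ * φ (t / ε)) := by
  -- adapted from `WeilCombSubcritical.isWeilTest_dil_autocorr` (private there)
  have h1 : IsWeilTest (fun t : ℝ => φ (t / ε)) := by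
    refine ⟨hφ.1.comp (contDiff_id.div_const ε), ?_⟩
    have e : (fun t : ℝ => φ (t / ε)) = φ ∘ (Homeomorph.mulRight₀ ε⁻¹ (inv_ne_zero hε)) := by
      ext t
      simp [div_eq_mul_inv]
    rw [e]
    exact hφ.2.comp_homeomorph _
  exact h1.const_mul _

/-- `W_∞(c · k) = c · W_∞(k)` (no hypotheses: `(c k)^ = c k̂` pointwise, and the integral is
homogeneous). [folklore] -/
private theorem weilArchTerm_const_mul_archGram (c : ℂ) (k : ℝ → ℂ) :
    weilArchTerm (fun t => c * k t) = c * weilArchTerm k := by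
  -- adapted from `WeilCombSubcritical.weilArchTerm_const_mul_arch` (private there)
  have hAI : weilArchIntegral (fun t => c * k t) = c * weilArchIntegral k := by
    simp only [weilArchIntegral, weilMellin_const_mul]
    rw [← integral_const_mul]
    congr 1 with t
    ring
  simp only [weilArchTerm, hAI]
  ring

/-- `W_∞(k₁ + k₂) = W_∞(k₁) + W_∞(k₂)` for Weil tests (`weilArchIntegral_add`). [folklore] -/
private theorem weilArchTerm_add_archGram {k₁ k₂ : ℝ → ℂ} (hk₁ : IsWeilTest k₁)
    (hk₂ : IsWeilTest k₂) :
    weilArchTerm (k₁ + k₂) = weilArchTerm k₁ + weilArchTerm k₂ := by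
  simp only [weilArchTerm, weilArchIntegral_add hk₁ hk₂, Pi.add_apply]
  ring

/-- `W_∞(0) = 0` (from the hypothesis-free homogeneity `W_∞(c k) = c W_∞(k)` at `c = 0`).
[folklore] -/
private theorem weilArchTerm_zero_fun_archGram : weilArchTerm (fun _ : ℝ => (0 : ℂ)) = 0 := by
  have h := weilArchTerm_const_mul_archGram 0 (fun _ : ℝ => (0 : ℂ))
  simp only [zero_mul] at h
  exact h

/-- A finite sum of Weil test functions is a Weil test function. [folklore] -/
private theorem isWeilTest_finset_sum_archGram {ι : Type*} (s : Finset ι) {F : ι → ℝ → ℂ}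
    (hF : ∀ i ∈ s, IsWeilTest (F i)) : IsWeilTest (fun t => ∑ i ∈ s, F i t) := by
  classical
  induction s using Finset.induction_on with
  | empty =>
    simp only [Finset.sum_empty]
    exact ⟨contDiff_const, HasCompactSupport.zero⟩
  | insert a s ha ih =>
    have h1 : IsWeilTest (F a) := hF a (Finset.mem_insert_self a s)
    have h2 : IsWeilTest (fun t => ∑ i ∈ s, F i t) :=
      ih fun i hi => hF i (Finset.mem_insert_of_mem hi)
    have h := h1.add h2
    convert h using 1
    funext t
    simp [Finset.sum_insert ha]

/-- `W_∞` is additive over finite sums of Weil test kernels: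
`W_∞(Σ_{i ∈ s} Fᵢ) = Σ_{i ∈ s} W_∞(Fᵢ)` (induction on `s` with `weilArchTerm_add`; the empty sum
is `W_∞(0) = 0`). [folklore] -/
private theorem weilArchTerm_finset_sum_archGram {ι : Type*} (s : Finset ι) {F : ι → ℝ → ℂ}
    (hF : ∀ i ∈ s, IsWeilTest (F i)) :
    weilArchTerm (fun t => ∑ i ∈ s, F i t) = ∑ i ∈ s, weilArchTerm (F i) := by
  classical
  induction s using Finset.induction_on with
  | empty =>
    simp only [Finset.sum_empty]
    exact weilArchTerm_zero_fun_archGram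
  | insert a s ha ih =>
    have h1 : IsWeilTest (F a) := hF a (Finset.mem_insert_self a s)
    have hF' : ∀ i ∈ s, IsWeilTest (F i) := fun i hi => hF i (Finset.mem_insert_of_mem hi)
    have h2 : IsWeilTest (fun t => ∑ i ∈ s, F i t) := isWeilTest_finset_sum_archGram s hF'
    have e : (fun t => ∑ i ∈ insert a s, F i t) = F a + fun t => ∑ i ∈ s, F i t := by
      funext t
      simp [Finset.sum_insert ha]
    rw [e, weilArchTerm_add_archGram h1 h2, ih hF', Finset.sum_insert ha]

/-- **Sub-goal (b) — archimedean Gram form.** For `ε > 0`, the archimedean term of the comb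
autocorrelation is the Hermitian form of the arch kernel `x ↦ W_∞(τ_x ψ_ε)` on the nodes `log m`:
`W_∞(g ⋆ g̃) = Σ_{m,m' ≤ M} a_m conj(a_{m'}) W_∞(τ_{log m − log m'} (φ_ε ⋆ φ̃_ε))`. [folklore] -/
theorem weilArchTerm_comb_eq_sum : ∀ ε : ℝ, 0 < ε → ∀ (M : ℕ) (a : ℕ → ℂ),
    weilArchTerm
      (weilConv (fun x : ℝ => ∑ m ∈ Finset.Icc 1 M,
          a m * ((ε : ℂ)⁻¹ * ((expNegInvGlue (1 - ((x - Real.log (m : ℝ)) / ε) ^ 2) : ℝ) : ℂ)))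
        (weilReflect (fun x : ℝ => ∑ m ∈ Finset.Icc 1 M,
          a m * ((ε : ℂ)⁻¹ * ((expNegInvGlue (1 - ((x - Real.log (m : ℝ)) / ε) ^ 2) : ℝ) : ℂ))))) =
      ∑ m ∈ Finset.Icc 1 M, ∑ m' ∈ Finset.Icc 1 M,
        a m * conj (a m') *
          weilArchTerm (weilTranslate
            (weilConv (fun t : ℝ => (ε : ℂ)⁻¹ * ((expNegInvGlue (1 - (t / ε) ^ 2) : ℝ) : ℂ))
              (weilReflect (fun t : ℝ => (ε : ℂ)⁻¹ * ((expNegInvGlue (1 - (t / ε) ^ 2) : ℝ) : ℂ))))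
            (Real.log (m : ℝ) - Real.log (m' : ℝ))) := by
  intro ε hε M a
  -- the fixed bump `φ₀` is a Weil test, hence so are `φ_ε` and `ψ_ε = φ_ε ⋆ φ̃_ε`
  have hφ : IsWeilTest (fun u : ℝ => ((expNegInvGlue (1 - u ^ 2) : ℝ) : ℂ)) :=
    Summit.RiemannHypothesis.RiemannHypothesis.Theorems.weilComb_shapeBump_isWeilTest
  have hdil : IsWeilTest (fun t : ℝ => (ε : ℂ)⁻¹ * ((expNegInvGlue (1 - (t / ε) ^ 2) : ℝ) : ℂ)) :=
    isWeilTest_dil_archGram hφ hε.ne'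
  have hψ : IsWeilTest
      (weilConv (fun t : ℝ => (ε : ℂ)⁻¹ * ((expNegInvGlue (1 - (t / ε) ^ 2) : ℝ) : ℂ))
        (weilReflect (fun t : ℝ => (ε : ℂ)⁻¹ * ((expNegInvGlue (1 - (t / ε) ^ 2) : ℝ) : ℂ)))) :=
    hdil.weilConv hdil.weilReflect
  -- the comb autocorrelation `g ⋆ g̃ = Σ a_m conj(a_{m'}) τ_{log m − log m'} ψ_ε`
  have hauto :=
    Summit.RiemannHypothesis.RiemannHypothesis.Theorems.WeilCombSubcritical.stub_autocorrelation
      (fun u : ℝ => ((expNegInvGlue (1 - u ^ 2) : ℝ) : ℂ)) hφ ε hε M a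
  beta_reduce at hauto
  rw [hauto]
  -- distribute `W_∞` over the double sum, then pull out the scalars
  rw [weilArchTerm_finset_sum_archGram _ fun m _ =>
    isWeilTest_finset_sum_archGram _ fun m' _ => (hψ.weilTranslate _).const_mul _]
  refine Finset.sum_congr rfl fun m _ => ?_
  rw [weilArchTerm_finset_sum_archGram _ fun m' _ => (hψ.weilTranslate _).const_mul _]
  refine Finset.sum_congr rfl fun m' _ => ?_
  exact weilArchTerm_const_mul_archGram _ _

end Summit.RiemannHypothesis.RiemannHypothesis.Theorems.WeilCombBohrFejer

end
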